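import Summits.CriticalPhenomena.PercolationContinuityZ3.Theorems.PercNearOneGluingNoHeavyQuantGatedSliceMixLawRegimeBTools
import HarnessLib

/-!
# QUANT lane R8, T-DEC, leg (III), blob case — `LawDec.GatedSliceMixLaw'` in REGIME B, cell B-G (`k₂` a giant): the FIRST KINK (the mid `h`
# exactly full of the shifted low `d = k₁ + a`, the low `k₁` and the zeros on the giants) REDUCED IN THE KERNEL TO ONE POLYNOMIAL INEQUALITY (⋆)

builds on p205010 (kernel theorem, internal audit signed; external expert review pending)

Support file (`--supports stmt-CriticalPhenomena-4575`), QUANT lane lead seat (gen 32), rung R8 of `run/shared/lean/prim/quant/LADDER.md`.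
Memo `run/shared/lean/prim/quant/prim-quant-lead-g32/FOR-PROVERS-MIXLAW-KINKS.md` §4–§5.  Theorems only, standard axioms, no sorries.
Companions: `…RegimeBTools` (`usage_mul_sub_le_light_or`, `mixLawB_QG`, `decAtT_weakMidLaw_of_giant`), `…RegimeBKink2` (the second kink).

THE RESIDUE OF CELL B-G.  `…RegimeBKink2` certifies the mixture whenever the low `k₁` obeys the usage bound at `h` (light pair, or `k₁ ≥ ag(1−z)`).
What is left of cell B-G (`h + a ≥ j+1`, `k₂ ≥ j+1`, `d = k₁ + a` a `t`-low, `h` a mid) is {`k₁` dear ∧ `k₁ < ag(1−z)`} ∪ {`k₁ + h ≤ t`}; there the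
certificate is the FIRST kink K1 (arm-3 g64's (K)/(E′), the typer's single donor): `θ = u_d m_d/(w_h + u_d m_d)`, flow = pair(`d → h`) + criterion E for
`{0, k₁}` against the giants `h + a, k₂, k₂ + a`; its inequality (E′) `u_d m_d (u w₀ − W_G) ≤ w_h((1−z)λ − uz − u m₁)` follows — given `u w₀ > W_G`, i.e.
`W_h ∉ D` (LOAD-BEARING here: (E′) fails for 1 906 W-DEC instances of the residue), and `u_d (h−S) ≤ t − d` — from S3 `(t−d) m_d X ≤ (h−S) S(1−g)(…)`, which is
affine in `k₂` and monotone to the top-affordability corner `k₂ = S/y` (with `k₂ ≥ h+1`: `y(h+1) ≤ S`), where it reads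
**(⋆)  (t − d)·g·(y(h − S) − (1−y)·S·g) ≤ y·(1 − g)·(h − S)·(g·S − k₁).**
Lead census (cellB2g/h: 2.6·10⁶ instances of the residue, `M ≤ 130`, `a ≤ 20`, W DEC or not): (E′) 0 failures given `W_h ∉ D`; S3 0 failures; (⋆) 0
failures AT EVERY `h` of the residue and at its real endpoint `h_max = min(S/y − 1, k₁ + (t−2k₁)/y)` ((⋆) is affine in `h` and trivial at `h = S`); for
`z = 0` the endpoint value is affine in `S` with slope `k₁[(c−1)(1−y)(1−2g) + g²(1−cy)] ≥ 0`, `c = ag/k₁ ∈ [1, 2−y]` (the `S²` terms cancel; at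
`c = 2−y` the slope is `k₁(1−y)²(1−g)²`) — memo §5.  THIS FILE proves the reduction with (⋆) as an explicit hypothesis; (⋆) on the residue is the
one remaining real-algebra lemma of cell B-G (owner: next lead / arm-3).

* `LawDec.mixLawB_S3_of_star` — (⋆) ∧ `X = u(h−S) − Sg ≥ 0` ∧ frame ⟹ S3 (affine in `k₂`, corner `k₂ = S/y`).
* **`LawDec.gatedSliceMixLaw_regimeB_kink1`** — cell B-G ∧ `W_h ∉ D` ∧ (⋆) ⟹ the conclusion of `GatedSliceMixLaw'` (first kink).

[this work]; exchange architecture: prim-quant-stmt g30; flow form / criterion E / usage closed forms: prim-quant-stmt g22–g27, arm-1 g39, lead g21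
(this lane); cell map: arm-3 g63–g64, lead g31–g32.  Nothing here is cited as a published result.  The gluing rows served
[cite: KozmaNitzan2024, Conjecture 3 (p. 15)]; product measure [cite: Grimmett1999, §1.3 p. 10].
-/

noncomputable section

namespace Summit.CriticalPhenomena.PercolationContinuityZ3.Theorems

namespace Quant

open Finset

/-- the two-point law `{lo, hi; g}` (as in `…QuantLawDEC`) -/
local notation3 "TP[" lo ", " hi ", " g ", " h "]" =>
  (g : ℝ) * (if (h : ℕ) = (hi : ℕ) then (1 : ℝ) else 0) + (1 - (g : ℝ)) * (if (h : ℕ) = (lo : ℕ) then (1 : ℝ) else 0)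

namespace LawDec

/-! ### S3 from (⋆) -/

set_option maxHeartbeats 400000 in
/-- **S3 from (⋆)** (`u = y/(1−y)`, `X = u(h−S) − Sg ≥ 0`): `(t−d)·m_d·X ≤ (h−S)·S(1−g)·((1−z)λ − uz − u m₁)` with `m_d = (1−z)(1−λ)g`,
`m₁ = (1−z)(1−λ)(1−g)`, `t − d = S + ag(1−z) − k₁ − a`.  Multiply by `k₂ − k₁`; the difference is affine in `k₂`, non-increasing, and at
`k₂ = S/y` equals `S(1−y−z)/(y(1−y))` times the slack of (⋆). [this work] -/
theorem mixLawB_S3_of_star (y z g S lam h a k₁ k₂ : ℝ) (hy0 : 0 < y) (hy1 : y < 1) (hz0 : 0 ≤ z) (hyz : y + z ≤ 1)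
    (hg0 : 0 ≤ g) (hg1 : g ≤ 1) (hS0 : 0 < S) (hSh : S < h)
    (hk : k₁ < k₂) (hyk₂ : y * k₂ ≤ S) (hTk₂ : S ≤ (1 - z) * k₂) (htd : 0 ≤ S + a * g * (1 - z) - k₁ - a)
    (hmean : (1 - z) * (k₁ + (k₂ - k₁) * lam) = S) (hX : 0 ≤ y / (1 - y) * (h - S) - S * g)
    (hstar : (S + a * g * (1 - z) - k₁ - a) * g * (y * (h - S) - (1 - y) * S * g) ≤ y * (1 - g) * (h - S) * (g * S - k₁)) :
    (S + a * g * (1 - z) - k₁ - a) * ((1 - z) * (1 - lam) * g) * (y / (1 - y) * (h - S) - S * g)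
      ≤ (h - S) * (S * (1 - g) * ((1 - z) * lam - y / (1 - y) * z - y / (1 - y) * ((1 - z) * (1 - lam) * (1 - g)))) := by
  have h1y : 0 < 1 - y := by linarith
  have hK : 0 < k₂ - k₁ := by linarith
  have hhS : 0 < h - S := by linarith
  set u : ℝ := y / (1 - y) with hu
  have hu0 : 0 < u := div_pos hy0 h1y
  set τ : ℝ := S + a * g * (1 - z) - k₁ - a with hτ
  have eA1 : (1 - z) * lam * (k₂ - k₁) = S - (1 - z) * k₁ := by linear_combination hmean
  have eA2 : (1 - z) * (1 - lam) * (k₂ - k₁) = (1 - z) * k₂ - S := by linear_combination -hmean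
  have hA2 : 0 ≤ (1 - z) * k₂ - S := by linarith
  refine le_of_mul_le_mul_right ?_ hK
  have eL : τ * ((1 - z) * (1 - lam) * g) * (u * (h - S) - S * g) * (k₂ - k₁)
      = τ * g * ((1 - z) * k₂ - S) * (u * (h - S) - S * g) := by
    rw [← eA2]; ring
  have eR : (h - S) * (S * (1 - g) * ((1 - z) * lam - u * z - u * ((1 - z) * (1 - lam) * (1 - g)))) * (k₂ - k₁)
      = (h - S) * S * (1 - g) * ((S - (1 - z) * k₁) - u * z * (k₂ - k₁) - u * (1 - g) * ((1 - z) * k₂ - S)) := by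
    rw [← eA1, ← eA2]; ring
  rw [eL, eR]
  -- both sides are affine in k₂; compare with the corner k₂ = S/y
  have hk₂le : k₂ ≤ S / y := by rw [le_div_iff₀ hy0]; linarith
  have hC0 : 0 ≤ (h - S) * S * (1 - g) := mul_nonneg (mul_nonneg hhS.le hS0.le) (by linarith)
  -- LHS(k₂) ≤ LHS(S/y)
  have hL : τ * g * ((1 - z) * k₂ - S) * (u * (h - S) - S * g) ≤ τ * g * ((1 - z) * (S / y) - S) * (u * (h - S) - S * g) := by
    have h1z : 0 ≤ 1 - z := by linarith
    have : (1 - z) * k₂ - S ≤ (1 - z) * (S / y) - S := by nlinarith [mul_le_mul_of_nonneg_left hk₂le h1z]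
    have hc : 0 ≤ τ * g * (u * (h - S) - S * g) := mul_nonneg (mul_nonneg htd hg0) hX
    calc τ * g * ((1 - z) * k₂ - S) * (u * (h - S) - S * g)
        = τ * g * (u * (h - S) - S * g) * ((1 - z) * k₂ - S) := by ring
      _ ≤ τ * g * (u * (h - S) - S * g) * ((1 - z) * (S / y) - S) := mul_le_mul_of_nonneg_left this hc
      _ = τ * g * ((1 - z) * (S / y) - S) * (u * (h - S) - S * g) := by ring
  -- RHS(k₂) ≥ RHS(S/y)
  have hR : (h - S) * S * (1 - g) * ((S - (1 - z) * k₁) - u * z * (S / y - k₁) - u * (1 - g) * ((1 - z) * (S / y) - S))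
      ≤ (h - S) * S * (1 - g) * ((S - (1 - z) * k₁) - u * z * (k₂ - k₁) - u * (1 - g) * ((1 - z) * k₂ - S)) := by
    refine mul_le_mul_of_nonneg_left ?_ hC0
    have h1 : u * z * (k₂ - k₁) ≤ u * z * (S / y - k₁) :=
      mul_le_mul_of_nonneg_left (by linarith) (mul_nonneg hu0.le hz0)
    have h2 : u * (1 - g) * ((1 - z) * k₂ - S) ≤ u * (1 - g) * ((1 - z) * (S / y) - S) := by
      have h1z : 0 ≤ 1 - z := by linarith
      have : (1 - z) * k₂ ≤ (1 - z) * (S / y) := mul_le_mul_of_nonneg_left hk₂le h1z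
      exact mul_le_mul_of_nonneg_left (by linarith) (mul_nonneg hu0.le (by linarith))
    linarith
  -- the corner values: LHS(S/y) = S(1−y−z)/(y(1−y))·τ g (y(h−S) − (1−y)Sg), RHS(S/y) = S(1−y−z)/(y(1−y))·y(1−g)(h−S)(gS−k₁)
  have eLc : τ * g * ((1 - z) * (S / y) - S) * (u * (h - S) - S * g)
      = S * (1 - y - z) / (y * (1 - y)) * (τ * g * (y * (h - S) - (1 - y) * S * g)) := by
    rw [hu]; field_simp; ring
  have eRc : (h - S) * S * (1 - g) * ((S - (1 - z) * k₁) - u * z * (S / y - k₁) - u * (1 - g) * ((1 - z) * (S / y) - S))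
      = S * (1 - y - z) / (y * (1 - y)) * (y * (1 - g) * (h - S) * (g * S - k₁)) := by
    rw [hu]; field_simp; ring
  have hfac : 0 ≤ S * (1 - y - z) / (y * (1 - y)) := div_nonneg (mul_nonneg hS0.le (by linarith)) (mul_pos hy0 h1y).le
  have hcorner : τ * g * ((1 - z) * (S / y) - S) * (u * (h - S) - S * g)
      ≤ (h - S) * S * (1 - g) * ((S - (1 - z) * k₁) - u * z * (S / y - k₁) - u * (1 - g) * ((1 - z) * (S / y) - S)) := by
    rw [eLc, eRc]
    exact mul_le_mul_of_nonneg_left hstar hfac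
  linarith

/-! ### Cell B-G: the first kink, modulo (⋆) -/

set_option maxHeartbeats 800000 in
/-- **`GatedSliceMixLaw'` ON CELL B-G AT THE FIRST KINK, MODULO (⋆)** — regime B (`h + a ≥ j+1`), `k₂ ≥ j+1`, `d = k₁ + a` a `t`-low, `h` a
mid, `W_h ∉ D`, and the polynomial inequality (⋆): the conclusion of `GatedSliceMixLaw'` at `θ = u_d m_d/(w_h + u_d m_d)` (the mid `h` exactly
full of `d`; `k₁` and the zeros ride the giants `h + a`, `k₂`, `k₂ + a`). [this work] -/
theorem gatedSliceMixLaw_regimeB_kink1 (y z g S lam : ℝ) (a j M h k₁ k₂ : ℕ)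
    (hy0 : 0 < y) (hy1 : y < 1) (hz0 : 0 ≤ z) (hz1 : z < 1) (hg1 : g ≤ 1) (hyg : y ≤ (1 - z) * g)
    (hS0 : 0 < S) (hta : y * (M : ℝ) ≤ S) (hhj : h ≤ j) (hhM : h ≤ M) (hSh : S < (h : ℝ))
    (hW : ¬ DECAtT y (S + (a : ℝ) * g * (1 - z)) j (M + a) (weakMidLaw S g h a))
    (hk : k₁ ≤ k₂) (hk₂M : k₂ ≤ M) (hlam0 : 0 ≤ lam) (hlam1 : lam ≤ 1)
    (hmean : (1 - z) * ((k₁ : ℝ) + ((k₂ : ℝ) - k₁) * lam) = S)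
    (hdlow : 2 * ((k₁ + a : ℕ) : ℝ) < S + (a : ℝ) * g * (1 - z)) (hdj : k₁ + a ≤ j) (hk₁j : k₁ ≤ j)
    (hk₂G : j + 1 ≤ k₂) (hhaG : j + 1 ≤ h + a) (hhmid : S + (a : ℝ) * g * (1 - z) ≤ 2 * (h : ℝ))
    (hstar : (S + (a : ℝ) * g * (1 - z) - k₁ - a) * g * (y * ((h : ℝ) - S) - (1 - y) * S * g)
      ≤ y * (1 - g) * ((h : ℝ) - S) * (g * S - k₁)) :
    ∃ θ : ℝ, 0 ≤ θ ∧ θ < 1 ∧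
      DECAtT y (S + (a : ℝ) * g * (1 - z)) j (M + a)
        (fun p => θ * weakMidLaw S g h a p
          + (1 - θ) * (z * (if p = 0 then (1 : ℝ) else 0) + (1 - z) * slice (fun q => TP[k₁, k₂, lam, q]) a g p)) := by
  classical
  set t : ℝ := S + (a : ℝ) * g * (1 - z) with ht
  -- positivity
  have h1z : 0 < 1 - z := by linarith
  have hg0 : 0 < g := by nlinarith
  have h1y : 0 < 1 - y := by linarith
  have ha0 : (0 : ℝ) ≤ a := Nat.cast_nonneg a
  have hk₁0 : (0 : ℝ) ≤ k₁ := Nat.cast_nonneg k₁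
  have hh0 : (0 : ℝ) < h := lt_trans hS0 hSh
  have hhS : 0 < (h : ℝ) - S := by linarith
  have hu0 : 0 < y / (1 - y) := div_pos hy0 h1y
  have h1lam : 0 ≤ 1 - lam := by linarith
  have hyz : y + z ≤ 1 := by nlinarith
  have hSt : S ≤ t := by rw [ht]; nlinarith [mul_nonneg (mul_nonneg ha0 hg0.le) h1z.le]
  have hdcast : ((k₁ + a : ℕ) : ℝ) = (k₁ : ℝ) + a := by push_cast; ring
  have hdlow' : 2 * ((k₁ : ℝ) + a) < t := by rw [← hdcast]; exact hdlow
  have hk1low : 2 * (k₁ : ℝ) < t := by linarith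
  have hyh : y * (h : ℝ) ≤ S := le_trans (mul_le_mul_of_nonneg_left (by exact_mod_cast hhM) hy0.le) hta
  have hyk₂ : y * (k₂ : ℝ) ≤ S := le_trans (mul_le_mul_of_nonneg_left (by exact_mod_cast hk₂M) hy0.le) hta
  have hk12 : (k₁ : ℝ) < k₂ := by
    have : k₁ < k₂ := by omega
    exact_mod_cast this
  have hTk₂ : S ≤ (1 - z) * (k₂ : ℝ) := by
    have : (k₁ : ℝ) + ((k₂ : ℝ) - k₁) * lam ≤ k₂ := by nlinarith
    nlinarith
  have htd : 0 ≤ S + (a : ℝ) * g * (1 - z) - k₁ - a := by rw [← ht]; linarith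
  -- from `W_h ∉ D`: the giant does not cover the zero, hence X > 0 and g < 1
  have hXw : ¬ (y / (1 - y) * (1 - S / h) ≤ S / h * g) := fun hcov =>
    hW (decAtT_weakMidLaw_of_giant y z g S a j M h hy0 hy1 hg0.le hg1 hS0.le hSh hhj hhM hhaG hhmid hcov)
  have hX : 0 < y / (1 - y) * ((h : ℝ) - S) - S * g := by
    have hlt := not_le.1 hXw
    have e1 : y / (1 - y) * ((h : ℝ) - S) - S * g = (y / (1 - y) * (1 - S / h) - S / h * g) * h := by
      field_simp
    rw [e1]; exact mul_pos (by linarith) hh0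
  have hg1' : g < 1 := by
    by_contra hge
    have hgeq : g = 1 := le_antisymm hg1 (not_lt.1 hge)
    apply hXw
    rw [hgeq, mul_one, div_mul_eq_mul_div, div_le_iff₀ h1y]
    -- y(1 − S/h) ≤ (S/h)(1 − y)  ⟸  y ≤ S/h
    have hys : y ≤ S / h := by rw [le_div_iff₀ hh0]; exact hyh
    nlinarith
  have h1g : 0 < 1 - g := by linarith
  -- masses
  set m₁ : ℝ := (1 - z) * (1 - lam) * (1 - g) with hm₁
  set m₂ : ℝ := (1 - z) * (1 - lam) * g with hm₂
  have hm₁0 : 0 ≤ m₁ := mul_nonneg (mul_nonneg h1z.le h1lam) h1g.le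
  have hm₂0 : 0 ≤ m₂ := mul_nonneg (mul_nonneg h1z.le h1lam) hg0.le
  have hwh : 0 < S / h * (1 - g) := mul_pos (div_pos hS0 hh0) h1g
  have hw0 : 0 ≤ 1 - S / (h : ℝ) := by rw [sub_nonneg, div_le_one hh0]; exact hSh.le
  have hWG : 0 ≤ S / h * g := mul_nonneg (div_pos hS0 hh0).le hg0.le
  -- the usage rate of d at h and its bound
  have hag1 : (a : ℝ) * g * (1 - z) ≤ a := by nlinarith [mul_nonneg ha0 hg0.le]
  have hcompd : t < ((k₁ + a : ℕ) : ℝ) + h := by rw [hdcast, ht]; linarith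
  have hdh : k₁ + a < h := by
    have : ((k₁ + a : ℕ) : ℝ) < h := by rw [hdcast]; linarith
    exact_mod_cast this
  have hUd0 : 0 < usage y t j (k₁ + a) h := usage_pos_of_compat y t j (k₁ + a) h hy0 hy1 hdlow hdh (Or.inr hcompd)
  have hUd : usage y t j (k₁ + a) h * ((h : ℝ) - S) ≤ t - ((k₁ + a : ℕ) : ℝ) :=
    usage_mul_sub_le_light_or y t S j (k₁ + a) h hy0 hy1 hdlow hhj hcompd hyh hSh hSt
      (Or.inr (by
        rw [hdcast, ht]
        have : (a : ℝ) * g * (1 - z) ≤ a := by nlinarith [mul_nonneg ha0 hg0.le]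
        linarith))
  obtain ⟨Ud, hUdd⟩ : ∃ q : ℝ, q = usage y t j (k₁ + a) h := ⟨_, rfl⟩
  rw [← hUdd] at hUd0 hUd
  obtain ⟨D, hD⟩ : ∃ q : ℝ, q = Ud * m₂ := ⟨_, rfl⟩
  have hD0 : 0 ≤ D := by rw [hD]; exact mul_nonneg hUd0.le hm₂0
  -- the giant inequality (E′): D(u w₀ − W_G) ≤ w_h((1−z)λ − uz − u m₁)
  have hE' : D * (y / (1 - y) * (1 - S / h) - S / h * g)
      ≤ S / h * (1 - g) * ((1 - z) * lam - y / (1 - y) * z - y / (1 - y) * m₁) := by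
    have eW : y / (1 - y) * (1 - S / h) - S / h * g = (y / (1 - y) * ((h : ℝ) - S) - S * g) / h := by
      field_simp
    have eR : S / h * (1 - g) * ((1 - z) * lam - y / (1 - y) * z - y / (1 - y) * m₁)
        = S * (1 - g) * ((1 - z) * lam - y / (1 - y) * z - y / (1 - y) * m₁) / h := by
      field_simp
    rw [eW, eR, mul_div_assoc', div_le_div_iff_of_pos_right hh0]
    have hS3 := mixLawB_S3_of_star y z g S lam h a k₁ k₂ hy0 hy1 hz0 hyz hg0.le hg1 hS0 hSh hk12 hyk₂ hTk₂ htd hmean hX.le hstar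
    -- D·X·(h−S) = Ud(h−S)·m₂·X ≤ (t−d)·m₂·X ≤ (h−S)·S(1−g)(…)
    have h1 : D * (y / (1 - y) * ((h : ℝ) - S) - S * g) * ((h : ℝ) - S)
        ≤ (t - ((k₁ + a : ℕ) : ℝ)) * m₂ * (y / (1 - y) * ((h : ℝ) - S) - S * g) := by
      have := mul_le_mul_of_nonneg_right hUd (mul_nonneg hm₂0 hX.le)
      calc D * (y / (1 - y) * ((h : ℝ) - S) - S * g) * ((h : ℝ) - S)
          = Ud * ((h : ℝ) - S) * (m₂ * (y / (1 - y) * ((h : ℝ) - S) - S * g)) := by rw [hD]; ring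
        _ ≤ (t - ((k₁ + a : ℕ) : ℝ)) * (m₂ * (y / (1 - y) * ((h : ℝ) - S) - S * g)) := this
        _ = _ := by ring
    have htd' : t - ((k₁ + a : ℕ) : ℝ) = S + (a : ℝ) * g * (1 - z) - k₁ - a := by rw [hdcast, ht]; ring
    rw [htd'] at h1
    have h2 : D * (y / (1 - y) * ((h : ℝ) - S) - S * g) * ((h : ℝ) - S)
        ≤ S * (1 - g) * ((1 - z) * lam - y / (1 - y) * z - y / (1 - y) * m₁) * ((h : ℝ) - S) := by
      calc D * (y / (1 - y) * ((h : ℝ) - S) - S * g) * ((h : ℝ) - S)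
          ≤ (S + (a : ℝ) * g * (1 - z) - k₁ - a) * m₂ * (y / (1 - y) * ((h : ℝ) - S) - S * g) := h1
        _ = (S + (a : ℝ) * g * (1 - z) - k₁ - a) * ((1 - z) * (1 - lam) * g) * (y / (1 - y) * ((h : ℝ) - S) - S * g) := by
            rw [hm₂]
        _ ≤ ((h : ℝ) - S) * (S * (1 - g) * ((1 - z) * lam - y / (1 - y) * z - y / (1 - y) * ((1 - z) * (1 - lam) * (1 - g)))) := hS3
        _ = S * (1 - g) * ((1 - z) * lam - y / (1 - y) * z - y / (1 - y) * m₁) * ((h : ℝ) - S) := by rw [hm₁]; ring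
    exact le_of_mul_le_mul_right h2 hhS
  -- flow pieces of the unnormalised mixture D·W_h + w_h·P
  have Pd := flowAtT_pair y t j (M + a) (k₁ + a) h (S / h * (1 - g) * m₂) (Ud * (S / h * (1 - g) * m₂)) hdj hdlow (by omega)
    (Or.inr hhmid) (Or.inr hcompd) (mul_nonneg hwh.le hm₂0) (le_of_eq (by rw [hUdd]))
  set G : ℕ → ℝ := fun p => (D * (1 - S / h) + S / h * (1 - g) * z) * (if p = 0 then (1 : ℝ) else 0)
      + S / h * (1 - g) * m₁ * (if p = k₁ then (1 : ℝ) else 0)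
      + D * (S / h * g) * (if p = h + a then (1 : ℝ) else 0)
      + S / h * (1 - g) * ((1 - z) * lam * (1 - g)) * (if p = k₂ then (1 : ℝ) else 0)
      + S / h * (1 - g) * ((1 - z) * lam * g) * (if p = k₂ + a then (1 : ℝ) else 0) with hG
  have hind : ∀ (q : Prop) [Decidable q], (0 : ℝ) ≤ (if q then (1 : ℝ) else 0) := by
    intro q _; split <;> norm_num
  have hc0 : 0 ≤ D * (1 - S / h) + S / h * (1 - g) * z := add_nonneg (mul_nonneg hD0 hw0) (mul_nonneg hwh.le hz0)
  have hc1 : 0 ≤ S / h * (1 - g) * m₁ := mul_nonneg hwh.le hm₁0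
  have hc2 : 0 ≤ D * (S / h * g) := mul_nonneg hD0 hWG
  have hc3 : 0 ≤ S / h * (1 - g) * ((1 - z) * lam * (1 - g)) := mul_nonneg hwh.le (mul_nonneg (mul_nonneg h1z.le hlam0) h1g.le)
  have hc4 : 0 ≤ S / h * (1 - g) * ((1 - z) * lam * g) := mul_nonneg hwh.le (mul_nonneg (mul_nonneg h1z.le hlam0) hg0.le)
  have hG0 : ∀ p, 0 ≤ G p := by
    intro p
    simp only [hG]
    exact add_nonneg (add_nonneg (add_nonneg (add_nonneg (mul_nonneg hc0 (hind _)) (mul_nonneg hc1 (hind _)))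
      (mul_nonneg hc2 (hind _))) (mul_nonneg hc3 (hind _))) (mul_nonneg hc4 (hind _))
  have hGlow : ∑ l ∈ Finset.range (j + 1), G l = D * (1 - S / h) + S / h * (1 - g) * z + S / h * (1 - g) * m₁ := by
    simp only [hG, Finset.sum_add_distrib]
    rw [sum_mul_indicator (fun _ => D * (1 - S / h) + S / h * (1 - g) * z) j 0 (by omega),
      sum_mul_indicator (fun _ => S / h * (1 - g) * m₁) j k₁ hk₁j,
      sum_mul_indicator_eq_zero (fun _ => D * (S / h * g)) j (h + a) (by omega),
      sum_mul_indicator_eq_zero (fun _ => S / h * (1 - g) * ((1 - z) * lam * (1 - g))) j k₂ (by omega),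
      sum_mul_indicator_eq_zero (fun _ => S / h * (1 - g) * ((1 - z) * lam * g)) j (k₂ + a) (by omega)]
    ring
  have hGall : ∑ p ∈ Finset.range (M + a + 1), G p
      = D * (1 - S / h) + S / h * (1 - g) * z + S / h * (1 - g) * m₁
        + (D * (S / h * g) + S / h * (1 - g) * ((1 - z) * lam * (1 - g)) + S / h * (1 - g) * ((1 - z) * lam * g)) := by
    simp only [hG, Finset.sum_add_distrib]
    rw [sum_mul_indicator (fun _ => D * (1 - S / h) + S / h * (1 - g) * z) (M + a) 0 (by omega),
      sum_mul_indicator (fun _ => S / h * (1 - g) * m₁) (M + a) k₁ (by omega),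
      sum_mul_indicator (fun _ => D * (S / h * g)) (M + a) (h + a) (by omega),
      sum_mul_indicator (fun _ => S / h * (1 - g) * ((1 - z) * lam * (1 - g))) (M + a) k₂ (by omega),
      sum_mul_indicator (fun _ => S / h * (1 - g) * ((1 - z) * lam * g)) (M + a) (k₂ + a) (by omega)]
    ring
  have hGIco : ∑ p ∈ Finset.Ico (j + 1) (M + a + 1), G p
      = D * (S / h * g) + S / h * (1 - g) * ((1 - z) * lam * (1 - g)) + S / h * (1 - g) * ((1 - z) * lam * g) := by
    have := Finset.sum_range_add_sum_Ico G (show j + 1 ≤ M + a + 1 by omega)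
    rw [hGall, hGlow] at this
    linarith
  have PG : FlowAtT y t j (M + a) G := by
    refine flowAtT_of_giants y t j (M + a) G hy0 hy1 hG0 ?_
    have hle : ∑ l ∈ Finset.range (j + 1), (if 2 * (l : ℝ) < t then G l else 0)
        ≤ D * (1 - S / h) + S / h * (1 - g) * z + S / h * (1 - g) * m₁ := by
      rw [← hGlow]
      exact Finset.sum_le_sum fun l _ => by
        by_cases h2 : 2 * (l : ℝ) < t
        · rw [if_pos h2]
        · rw [if_neg h2]; exact hG0 l
    rw [hGIco]
    refine le_trans (mul_le_mul_of_nonneg_left hle hu0.le) ?_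
    have e : D * (S / h * g) + S / h * (1 - g) * ((1 - z) * lam * (1 - g)) + S / h * (1 - g) * ((1 - z) * lam * g)
        = D * (S / h * g) + S / h * (1 - g) * ((1 - z) * lam) := by ring
    rw [e]
    have e2 : y / (1 - y) * (D * (1 - S / ↑h) + S / ↑h * (1 - g) * z + S / ↑h * (1 - g) * m₁)
        = D * (y / (1 - y) * (1 - S / h)) + S / h * (1 - g) * (y / (1 - y) * z + y / (1 - y) * m₁) := by ring
    have e3 : D * (S / ↑h * g) + S / ↑h * (1 - g) * ((1 - z) * lam)
        = D * (S / h * g) + S / h * (1 - g) * ((1 - z) * lam) := rfl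
    rw [e2]
    have h4 : D * (y / (1 - y) * (1 - S / h)) + S / h * (1 - g) * (y / (1 - y) * z + y / (1 - y) * m₁)
        ≤ D * (S / h * g) + S / h * (1 - g) * ((1 - z) * lam) := by
      have e4 : D * (y / (1 - y) * (1 - S / h)) + S / h * (1 - g) * (y / (1 - y) * z + y / (1 - y) * m₁)
          - (D * (S / h * g) + S / h * (1 - g) * ((1 - z) * lam))
          = D * (y / (1 - y) * (1 - S / h) - S / h * g) - S / h * (1 - g) * ((1 - z) * lam - y / (1 - y) * z - y / (1 - y) * m₁) := by
        ring
      linarith [hE', e4]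
    exact h4
  -- assemble the unnormalised mixture
  have hsum := FlowAtT.add Pd PG
  have key : ∀ p, D * weakMidLaw S g h a p
        + S / h * (1 - g) * (z * (if p = 0 then (1 : ℝ) else 0) + (1 - z) * slice (fun q => TP[k₁, k₂, lam, q]) a g p)
      = (S / h * (1 - g) * m₂ * (if p = k₁ + a then (1 : ℝ) else 0) + Ud * (S / h * (1 - g) * m₂) * (if p = h then (1 : ℝ) else 0))
        + G p := by
    intro p
    rw [movedTwoPoint_apply]
    simp only [weakMidLaw, hG, hm₁, hm₂]
    rw [hD, hm₂]
    ring
  have hR' : FlowAtT y t j (M + a) (fun p => D * weakMidLaw S g h a p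
      + S / h * (1 - g) * (z * (if p = 0 then (1 : ℝ) else 0) + (1 - z) * slice (fun q => TP[k₁, k₂, lam, q]) a g p)) := by
    refine (congrArg (FlowAtT y t j (M + a)) (funext fun p => ?_)).mp hsum
    exact (key p).symm
  -- normalise
  have hden : 0 < S / h * (1 - g) + D := add_pos_of_pos_of_nonneg hwh hD0
  obtain ⟨θ, hθ⟩ : ∃ q : ℝ, q = D / (S / h * (1 - g) + D) := ⟨_, rfl⟩
  have hθ0 : 0 ≤ θ := by rw [hθ]; exact div_nonneg hD0 hden.le
  have hθ1 : θ < 1 := by rw [hθ, div_lt_one hden]; linarith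
  have h1θ : 1 - θ = S / h * (1 - g) / (S / h * (1 - g) + D) := by
    rw [hθ]; field_simp; ring
  have hR := hR'.smul (1 / (S / h * (1 - g) + D)) (by positivity)
  refine gatedSliceMixLaw_conclusion_of_flowAtT y z g S lam θ a j M h k₁ k₂ hy0 hy1 hhM hk hk₂M hθ0 hθ1 ?_
  refine (congrArg (FlowAtT y t j (M + a)) (funext fun p => ?_)).mp hR
  rw [h1θ, hθ, div_eq_mul_one_div D, div_eq_mul_one_div (S / h * (1 - g)) (S / h * (1 - g) + D)]
  ring

end LawDec

end Quant

end Summit.CriticalPhenomena.PercolationContinuityZ3.Theorems
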